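import Summits.Ventures.PercRepro.C026PFunDefs

/-!
# Opening one edge merges at most two clusters: `n̄(ω + e) ≥ ½·n̄(ω)` (p6, gen 16; mine-3 §29 (b))

Opening the edge `e = ab` in `ω` leaves the clusters unchanged when `a ↔ b` already, and otherwise
replaces the two clusters `C_a`, `C_b` by their union (`clusters_update_true_of_not_conn`).  In the
product `n̄ = ∏_R (2 − X_R)` the two factors `(2 − α)(2 − β)` (`α = X_{C_a}`, `β = X_{C_b}`) become
`2 − αβ`, and `2 − αβ ≥ ½(2 − α)(2 − β)` on `[0, 1]²` (`⟺ 2α + 2β ≥ 3αβ`): this is the one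
inequality behind the half-monotonicity LEMMA of mine-3 §29 (b), `nbar_le_two_mul_nbar_update_true`.
-/

namespace PercRepro

namespace MultiGraph

open Finset

variable {V E : Type*} [Fintype V] [DecidableEq E] {G : MultiGraph V E}

section ClusterUpdate

variable {ω : Config E} {e : E}

omit [Fintype V] in
/-- If the endpoints of `e` are already connected, opening `e` changes no connection. -/
theorem conn_update_true_iff_of_conn (h : G.Conn ω (G.fst e) (G.snd e)) (u v : V) :
    G.Conn (Function.update ω e true) u v ↔ G.Conn ω u v := by
  rw [conn_update_true_iff]
  constructor
  · rintro (h1 | ⟨h1, h2⟩ | ⟨h1, h2⟩)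
    · exact h1
    · exact h1.trans (h.trans h2)
    · exact h1.trans (h.symm.trans h2)
  · exact Or.inl

/-- If the endpoints of `e` are already connected, opening `e` changes no cluster. -/
theorem clusterF_update_true_of_conn (h : G.Conn ω (G.fst e) (G.snd e)) (v : V) :
    G.clusterF (Function.update ω e true) v = G.clusterF ω v := by
  ext u
  simp only [mem_clusterF]
  exact conn_update_true_iff_of_conn h v u

/-- If the endpoints of `e` are not connected and `v ↔ a`, the cluster of `v` after opening
`e = ab` is `C_a ∪ C_b`. -/
theorem clusterF_update_true_of_conn_fst [DecidableEq V] (h : ¬ G.Conn ω (G.fst e) (G.snd e))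
    {v : V} (hva : G.Conn ω v (G.fst e)) :
    G.clusterF (Function.update ω e true) v = G.clusterF ω (G.fst e) ∪ G.clusterF ω (G.snd e) := by
  ext u
  simp only [mem_clusterF, conn_update_true_iff, Finset.mem_union]
  constructor
  · rintro (h1 | ⟨_, h2⟩ | ⟨h1, _⟩)
    · exact Or.inl (hva.symm.trans h1)
    · exact Or.inr h2
    · exact absurd (hva.symm.trans h1) h
  · rintro (h1 | h1)
    · exact Or.inl (hva.trans h1)
    · exact Or.inr (Or.inl ⟨hva, h1⟩)

/-- If the endpoints of `e` are not connected and `v ↔ b`, the cluster of `v` after opening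
`e = ab` is `C_a ∪ C_b`. -/
theorem clusterF_update_true_of_conn_snd [DecidableEq V] (h : ¬ G.Conn ω (G.fst e) (G.snd e))
    {v : V} (hvb : G.Conn ω v (G.snd e)) :
    G.clusterF (Function.update ω e true) v = G.clusterF ω (G.fst e) ∪ G.clusterF ω (G.snd e) := by
  ext u
  simp only [mem_clusterF, conn_update_true_iff, Finset.mem_union]
  constructor
  · rintro (h1 | ⟨h1, _⟩ | ⟨_, h2⟩)
    · exact Or.inr (hvb.symm.trans h1)
    · exact absurd (h1.symm.trans hvb) h
    · exact Or.inl h2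
  · rintro (h1 | h1)
    · exact Or.inr (Or.inr ⟨hvb, h1⟩)
    · exact Or.inl (hvb.trans h1)

/-- If `v` is connected to neither endpoint of `e`, opening `e` does not change its cluster. -/
theorem clusterF_update_true_of_not_conn_both {v : V} (hva : ¬ G.Conn ω v (G.fst e))
    (hvb : ¬ G.Conn ω v (G.snd e)) :
    G.clusterF (Function.update ω e true) v = G.clusterF ω v := by
  ext u
  simp only [mem_clusterF, conn_update_true_iff]
  constructor
  · rintro (h1 | ⟨h1, _⟩ | ⟨h1, _⟩)
    · exact h1
    · exact absurd h1 hva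
    · exact absurd h1 hvb
  · exact Or.inl

variable [DecidableEq V]

/-- If the endpoints of `e` are already connected, opening `e` changes the set of clusters not. -/
theorem clusters_update_true_of_conn (h : G.Conn ω (G.fst e) (G.snd e)) :
    G.clusters (Function.update ω e true) = G.clusters ω := by
  unfold clusters
  congr 1
  funext v
  exact clusterF_update_true_of_conn h v

omit [DecidableEq E] in
/-- The union of the clusters of two non-connected vertices is not a cluster. -/
theorem union_not_mem_clusters {a b : V} (h : ¬ G.Conn ω a b) :
    G.clusterF ω a ∪ G.clusterF ω b ∉ G.clusters ω := by
  intro hmem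
  have ha : a ∈ G.clusterF ω a ∪ G.clusterF ω b :=
    Finset.mem_union_left _ (self_mem_clusterF ω a)
  have hb : b ∈ G.clusterF ω a ∪ G.clusterF ω b :=
    Finset.mem_union_right _ (self_mem_clusterF ω b)
  exact h (conn_of_clusterF_eq ((clusterF_eq_of_mem hmem ha).trans (clusterF_eq_of_mem hmem hb).symm))

/-- **Single-merge lemma** for the set of clusters: if the endpoints of `e` are not connected,
opening `e` replaces the two clusters `C_a`, `C_b` by their union. -/
theorem clusters_update_true_of_not_conn (h : ¬ G.Conn ω (G.fst e) (G.snd e)) :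
    G.clusters (Function.update ω e true) =
      insert (G.clusterF ω (G.fst e) ∪ G.clusterF ω (G.snd e))
        (((G.clusters ω).erase (G.clusterF ω (G.fst e))).erase (G.clusterF ω (G.snd e))) := by
  ext R
  rw [mem_clusters, Finset.mem_insert, Finset.mem_erase, Finset.mem_erase, mem_clusters]
  constructor
  · rintro ⟨v, rfl⟩
    by_cases hva : G.Conn ω v (G.fst e)
    · exact Or.inl (clusterF_update_true_of_conn_fst h hva)
    by_cases hvb : G.Conn ω v (G.snd e)
    · exact Or.inl (clusterF_update_true_of_conn_snd h hvb)
    rw [clusterF_update_true_of_not_conn_both hva hvb]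
    exact Or.inr ⟨fun heq => hvb (conn_of_clusterF_eq heq),
      fun heq => hva (conn_of_clusterF_eq heq), v, rfl⟩
  · rintro (rfl | ⟨hb, ha, v, rfl⟩)
    · exact ⟨G.fst e, clusterF_update_true_of_conn_fst h (Conn.refl G ω _)⟩
    · refine ⟨v, clusterF_update_true_of_not_conn_both ?_ ?_⟩
      · exact fun hc => ha (clusterF_eq_of_conn hc)
      · exact fun hc => hb (clusterF_eq_of_conn hc)

end ClusterUpdate

section NbarMerge

variable [DecidableEq V] {x : V → ℝ} {ω : Config E} {e : E}

/-- `n̄` is unchanged by opening an edge whose endpoints are connected. -/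
theorem nbar_update_true_of_conn (x : V → ℝ) (h : G.Conn ω (G.fst e) (G.snd e)) :
    G.nbar x (Function.update ω e true) = G.nbar x ω := by
  unfold nbar
  rw [clusters_update_true_of_conn h]

/-- `n̄` after opening an edge with non-connected endpoints: the merged factor times the rest. -/
theorem nbar_update_true_of_not_conn (x : V → ℝ) (h : ¬ G.Conn ω (G.fst e) (G.snd e)) :
    G.nbar x (Function.update ω e true) =
      (2 - (∏ v ∈ G.clusterF ω (G.fst e), x v) * ∏ v ∈ G.clusterF ω (G.snd e), x v) *
        ∏ R ∈ ((G.clusters ω).erase (G.clusterF ω (G.fst e))).erase (G.clusterF ω (G.snd e)),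
          (2 - ∏ v ∈ R, x v) := by
  unfold nbar
  rw [clusters_update_true_of_not_conn h, Finset.prod_insert, Finset.prod_union]
  · exact disjoint_clusterF_of_not_conn h
  · intro hmem
    exact union_not_mem_clusters h (Finset.mem_of_mem_erase (Finset.mem_of_mem_erase hmem))

omit [DecidableEq E] in
/-- `n̄` before opening an edge with non-connected endpoints: the two factors times the rest. -/
theorem nbar_eq_of_not_conn (x : V → ℝ) (h : ¬ G.Conn ω (G.fst e) (G.snd e)) :
    G.nbar x ω =
      (2 - ∏ v ∈ G.clusterF ω (G.fst e), x v) * ((2 - ∏ v ∈ G.clusterF ω (G.snd e), x v) *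
        ∏ R ∈ ((G.clusters ω).erase (G.clusterF ω (G.fst e))).erase (G.clusterF ω (G.snd e)),
          (2 - ∏ v ∈ R, x v)) := by
  unfold nbar
  have hne : G.clusterF ω (G.snd e) ≠ G.clusterF ω (G.fst e) := fun heq =>
    h (conn_of_clusterF_eq heq).symm
  rw [← Finset.mul_prod_erase _ _ (clusterF_mem_clusters ω (G.fst e)),
    ← Finset.mul_prod_erase _ _ (Finset.mem_erase.2 ⟨hne, clusterF_mem_clusters ω (G.snd e)⟩)]

/-- The one inequality of the merge: `(2 − α)(2 − β) ≤ 2(2 − αβ)` on `[0, 1]²`. -/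
theorem two_sub_mul_two_sub_le {α β : ℝ} (hα : 0 ≤ α ∧ α ≤ 1) (hβ : 0 ≤ β ∧ β ≤ 1) :
    (2 - α) * (2 - β) ≤ 2 * (2 - α * β) := by
  nlinarith [mul_le_of_le_one_right hα.1 hβ.2, mul_le_of_le_one_left hβ.1 hα.2]

/-- **Half-monotonicity of `n̄` under opening an edge** (mine-3 §29 (b)): for cells in `[0, 1]`,
`n̄(ω) ≤ 2·n̄(ω + e)`. -/
theorem nbar_le_two_mul_nbar_update_true (hx : ∀ v, 0 ≤ x v ∧ x v ≤ 1) (ω : Config E) (e : E) :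
    G.nbar x ω ≤ 2 * G.nbar x (Function.update ω e true) := by
  by_cases h : G.Conn ω (G.fst e) (G.snd e)
  · rw [nbar_update_true_of_conn x h]
    have := nbar_nonneg (G := G) hx ω
    linarith
  · rw [nbar_update_true_of_not_conn x h, nbar_eq_of_not_conn x h]
    have hα : 0 ≤ ∏ v ∈ G.clusterF ω (G.fst e), x v ∧ ∏ v ∈ G.clusterF ω (G.fst e), x v ≤ 1 :=
      ⟨Finset.prod_nonneg fun v _ => (hx v).1,
        Finset.prod_le_one (fun v _ => (hx v).1) (fun v _ => (hx v).2)⟩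
    have hβ : 0 ≤ ∏ v ∈ G.clusterF ω (G.snd e), x v ∧ ∏ v ∈ G.clusterF ω (G.snd e), x v ≤ 1 :=
      ⟨Finset.prod_nonneg fun v _ => (hx v).1,
        Finset.prod_le_one (fun v _ => (hx v).1) (fun v _ => (hx v).2)⟩
    have hP : 0 ≤ ∏ R ∈ ((G.clusters ω).erase (G.clusterF ω (G.fst e))).erase
        (G.clusterF ω (G.snd e)), (2 - ∏ v ∈ R, x v) :=
      Finset.prod_nonneg fun R _ => zero_le_one.trans (one_le_two_sub_prod hx R)
    have key := two_sub_mul_two_sub_le hα hβ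
    calc (2 - ∏ v ∈ G.clusterF ω (G.fst e), x v) * ((2 - ∏ v ∈ G.clusterF ω (G.snd e), x v) *
          ∏ R ∈ ((G.clusters ω).erase (G.clusterF ω (G.fst e))).erase (G.clusterF ω (G.snd e)),
            (2 - ∏ v ∈ R, x v))
        = ((2 - ∏ v ∈ G.clusterF ω (G.fst e), x v) * (2 - ∏ v ∈ G.clusterF ω (G.snd e), x v)) *
          ∏ R ∈ ((G.clusters ω).erase (G.clusterF ω (G.fst e))).erase (G.clusterF ω (G.snd e)),
            (2 - ∏ v ∈ R, x v) := by ring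
      _ ≤ (2 * (2 - (∏ v ∈ G.clusterF ω (G.fst e), x v) * ∏ v ∈ G.clusterF ω (G.snd e), x v)) *
          ∏ R ∈ ((G.clusters ω).erase (G.clusterF ω (G.fst e))).erase (G.clusterF ω (G.snd e)),
            (2 - ∏ v ∈ R, x v) := mul_le_mul_of_nonneg_right key hP
      _ = _ := by ring

end NbarMerge

end MultiGraph

end PercRepro
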